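import Literature.Analysis.FunctionSpaces.ParametricIntegralSmooth
import Mathlib.Analysis.Calculus.ContDiff.Bounds
import HarnessLib

/-!
# Iterated derivatives of parametric integrals

Analysis/FunctionSpaces support file, continuation of `ParametricIntegralSmooth.lean`: under the
same hypotheses (finite measure `μ` on `W`, integration variable entering through a measurable
`ι : W → V` with values a.e. in a compact `K`, smooth integrand `G : V × P → F`, `P` finite
dimensional), the iterated Fréchet derivatives of `p ↦ ∫ G (ι w, p) dμ(w)` are the integrals of
the iterated derivatives of the sections `r ↦ G (ι w, r)`, whence the norm bound
`‖D^n ∫ G‖ ≤ ∫ ‖D^n G‖` used for weighted `C^n` estimates of collision operators. Everything is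
proved; theorems only.

* `iteratedFDeriv_section_right`: `D^n (G (y, ·)) (p) = D^n G (y, p) ∘ (inr, …, inr)`;
  `contDiff_iteratedFDeriv_section_right`: the partial iterated derivative is smooth in `(y, p)`.
* `iteratedFDeriv_parametric_integral` (induction on `n`: the `n`-th derivative is the parametric
  integral of the smooth partial derivative, differentiated once more by
  `hasFDerivAt_parametric_integral`, the currying isometry commuting with the Bochner integral),
  `norm_iteratedFDeriv_parametric_integral_le`, `integrable_iteratedFDeriv_section`.

## References

* L. Hörmander, *The Analysis of Linear Partial Differential Operators I*, 2nd ed. (1990),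
  Thm. 1.1.9.
-/

noncomputable section

open MeasureTheory Set Filter Topology Metric
open scoped ContDiff

namespace Literature.Analysis.FunctionSpaces

variable {W : Type*} [MeasurableSpace W] {μ : Measure W}
variable {V : Type*} [NormedAddCommGroup V] [NormedSpace ℝ V] [SecondCountableTopology V]
  [MeasurableSpace V] [BorelSpace V]
variable {P : Type*} [NormedAddCommGroup P] [NormedSpace ℝ P] [FiniteDimensional ℝ P]
variable {F : Type*} [NormedAddCommGroup F] [NormedSpace ℝ F]

omit [SecondCountableTopology V] [MeasurableSpace V] [BorelSpace V] [FiniteDimensional ℝ P] in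
/-- **Partial iterated derivatives through total ones**: the `n`-th derivative in `p` of
`r ↦ G (y, r)` is the `n`-th derivative of `G` at `(y, p)` composed with the inclusion `(0, ·)` in
each slot. [folklore] -/
theorem iteratedFDeriv_section_right {G : V × P → F} (hG : ContDiff ℝ ∞ G) (y : V) (p : P) (n : ℕ) :
    iteratedFDeriv ℝ n (fun r : P => G (y, r)) p =
      (iteratedFDeriv ℝ n G (y, p)).compContinuousLinearMap fun _ => ContinuousLinearMap.inr ℝ V P := by
  set G' : V × P → F := fun r => G (r + (y, 0)) with hG'
  have hG's : ContDiff ℝ ∞ G' := hG.comp (contDiff_id.add contDiff_const)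
  have h1 : (fun r : P => G (y, r)) = G' ∘ (ContinuousLinearMap.inr ℝ V P) := by
    funext r; simp [hG']
  rw [h1, ContinuousLinearMap.iteratedFDeriv_comp_right _ hG's _ (by exact_mod_cast le_top)]
  have h2 : iteratedFDeriv ℝ n G' (ContinuousLinearMap.inr ℝ V P p) = iteratedFDeriv ℝ n G (y, p) := by
    rw [hG', iteratedFDeriv_comp_add_right]
    simp
  rw [h2]

omit [SecondCountableTopology V] [MeasurableSpace V] [BorelSpace V] [FiniteDimensional ℝ P] in
/-- The partial iterated derivative `(y, p) ↦ D_p^n G (y, ·) (p)` of a smooth function is smooth.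
[folklore] -/
theorem contDiff_iteratedFDeriv_section_right {G : V × P → F} (hG : ContDiff ℝ ∞ G) (n : ℕ) :
    ContDiff ℝ ∞ fun q : V × P => iteratedFDeriv ℝ n (fun r : P => G (q.1, r)) q.2 := by
  have h : (fun q : V × P => iteratedFDeriv ℝ n (fun r : P => G (q.1, r)) q.2) =
      (ContinuousMultilinearMap.compContinuousLinearMapL (fun _ => ContinuousLinearMap.inr ℝ V P)) ∘
        iteratedFDeriv ℝ n G := by
    funext q
    rw [iteratedFDeriv_section_right hG q.1 q.2 n]
    rfl
  rw [h]
  exact (ContinuousLinearMap.contDiff _).comp (hG.iteratedFDeriv_right (by exact_mod_cast le_top))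

variable [IsFiniteMeasure μ]

/-- **Iterated differentiation under the integral sign.** Under the hypotheses of
`contDiff_parametric_integral` (finite measure, integration variable entering through a measurable
map with values a.e. in a compact set, smooth integrand), all iterated derivatives of
`p ↦ ∫ G (ι w, p) dμ` are the integrals of the iterated derivatives of the sections. [folklore] -/
theorem iteratedFDeriv_parametric_integral {ι : W → V} (hι : Measurable ι)
    {K : Set V} (hK : IsCompact K) (hιK : ∀ᵐ w ∂μ, ι w ∈ K) {G : V × P → F} (hG : ContDiff ℝ ∞ G) :
    ∀ (n : ℕ) (p : P), iteratedFDeriv ℝ n (fun p : P => ∫ w, G (ι w, p) ∂μ) p =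
      ∫ w, iteratedFDeriv ℝ n (fun r : P => G (ι w, r)) p ∂μ
  | 0, p => by
    simp only [iteratedFDeriv_zero_eq_comp, Function.comp_apply]
    exact ((continuousMultilinearCurryFin0 ℝ P F).symm.toContinuousLinearEquiv.integral_comp_comm _).symm
  | n + 1, p => by
    have h1 : (∞ : WithTop ℕ∞) ≠ 0 := by exact_mod_cast WithTop.coe_ne_zero.2 (by decide)
    -- the `n`-th derivative as a parametric integral of the smooth `H`
    set H : V × P → ContinuousMultilinearMap ℝ (fun _ : Fin n => P) F :=
      fun q => iteratedFDeriv ℝ n (fun r : P => G (q.1, r)) q.2 with hH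
    have hHs : ContDiff ℝ ∞ H := contDiff_iteratedFDeriv_section_right hG n
    have hIH : iteratedFDeriv ℝ n (fun p : P => ∫ w, G (ι w, p) ∂μ) = fun p => ∫ w, H (ι w, p) ∂μ :=
      funext fun p => iteratedFDeriv_parametric_integral hι hK hιK hG n p
    rw [iteratedFDeriv_succ_eq_comp_left, Function.comp_apply, hIH,
      (hasFDerivAt_parametric_integral hι hK hιK hHs h1 p).fderiv]
    set L := (continuousMultilinearCurryLeftEquiv ℝ (fun _ : Fin (n + 1) => P) F).symm with hL
    have hcomm : L (∫ w, (fderiv ℝ H (ι w, p)).comp (ContinuousLinearMap.inr ℝ V P) ∂μ) =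
        ∫ w, L ((fderiv ℝ H (ι w, p)).comp (ContinuousLinearMap.inr ℝ V P)) ∂μ := by
      have h := ContinuousLinearEquiv.integral_comp_comm (𝕜 := ℝ) (μ := μ) L.toContinuousLinearEquiv
        (fun w => (fderiv ℝ H (ι w, p)).comp (ContinuousLinearMap.inr ℝ V P))
      exact h.symm
    rw [hcomm]
    refine integral_congr_ae (Eventually.of_forall fun w => ?_)
    -- pointwise: `curryLeft⁻¹ (D_p H (y, p)) = D_p^{n+1} G (y, ·) (p)`
    have hfd : (fderiv ℝ H (ι w, p)).comp (ContinuousLinearMap.inr ℝ V P) =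
        fderiv ℝ (iteratedFDeriv ℝ n fun r : P => G (ι w, r)) p :=
      (hasFDerivAt_comp_prodMk_right hHs h1 (ι w) p).fderiv.symm
    simp only [hL, hfd, iteratedFDeriv_succ_eq_comp_left, Function.comp_apply]

/-- **Norm bound for iterated derivatives of parametric integrals**:
`‖D^n (∫ G (ι w, ·) dμ) (p)‖ ≤ ∫ ‖D^n G (ι w, ·) (p)‖ dμ`. [folklore] -/
theorem norm_iteratedFDeriv_parametric_integral_le {ι : W → V} (hι : Measurable ι)
    {K : Set V} (hK : IsCompact K) (hιK : ∀ᵐ w ∂μ, ι w ∈ K) {G : V × P → F} (hG : ContDiff ℝ ∞ G)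
    (n : ℕ) (p : P) :
    ‖iteratedFDeriv ℝ n (fun p : P => ∫ w, G (ι w, p) ∂μ) p‖ ≤
      ∫ w, ‖iteratedFDeriv ℝ n (fun r : P => G (ι w, r)) p‖ ∂μ := by
  rw [iteratedFDeriv_parametric_integral hι hK hιK hG n p]
  exact norm_integral_le_integral_norm _

omit [FiniteDimensional ℝ P] in
/-- The sections' iterated derivatives are integrable (bounded a.e. on the compact `K`). [folklore] -/
theorem integrable_iteratedFDeriv_section {ι : W → V} (hι : Measurable ι)
    {K : Set V} (hK : IsCompact K) (hιK : ∀ᵐ w ∂μ, ι w ∈ K) {G : V × P → F} (hG : ContDiff ℝ ∞ G)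
    (n : ℕ) (p : P) :
    Integrable (fun w => iteratedFDeriv ℝ n (fun r : P => G (ι w, r)) p) μ := by
  have hHs : ContDiff ℝ ∞ fun q : V × P => iteratedFDeriv ℝ n (fun r : P => G (q.1, r)) q.2 :=
    contDiff_iteratedFDeriv_section_right hG n
  obtain ⟨C, hC⟩ : ∃ C, ∀ q ∈ K ×ˢ ({p} : Set P), ‖iteratedFDeriv ℝ n (fun r : P => G (q.1, r)) q.2‖ ≤ C :=
    (hK.prod isCompact_singleton).exists_bound_of_continuousOn hHs.continuous.continuousOn
  refine Integrable.mono' (integrable_const C) (aestronglyMeasurable_comp_section hι hHs.continuous p μ) ?_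
  exact hιK.mono fun w hw => hC (ι w, p) ⟨hw, rfl⟩

end Literature.Analysis.FunctionSpaces

end
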